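import Summits.AtomisticToContinuum.FouriersLaw.Theses.ContactStieltjesMeasure
import Summits.AtomisticToContinuum.FouriersLaw.Theorems.ContactStieltjesMeasureStieltjesRepresentationOfPhi4Edge

/-!
# Crux `ContactStieltjesMeasure.StieltjesRepresentation` (stmt-AtomisticToContinuum-15248), line `cayley-pencil`:
# K2 is DISCHARGED for the route — `FouriersLaw` from the three remaining cruxes

Support file (`--supports stmt-AtomisticToContinuum-15248`). The route's deciding theorem
`Theses.ContactStieltjesMeasure.closes : StieltjesRepresentation → ContactUpperDensity → ContactMeasureLimit →
ConductanceLowerBound → FouriersLaw` consumes the crux K2 (`StieltjesRepresentation`, stated on `0 ≤ lam`, `0 ≤ β`) at ONE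
place, and there only on the conjunct's range `0 < lam`, `0 < β` (`hRep ω₂ lam β hω hl.le hβ.le T hT`). On that range K2 is a
THEOREM of the tree: `CayleyPencil.stub_stieltjesRepresentation_pos` (p165646; boundary Green–Kubo + dissipative pencil +
Cayley/Herglotz Stieltjes representation). Hence:

* `fouriersLaw_of_pos_of_contact` — the deciding theorem with its first hypothesis WEAKENED to the positive-range form of K2
  (the body is that of `closes`, with `hβ.le ↦ hβ` at the single use site);
* `fouriersLaw_of_contact` — **`ContactUpperDensity → ContactMeasureLimit → ConductanceLowerBound → FouriersLaw`**, sorry-free: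
  the crux K2 is no longer load-bearing for route `ContactStieltjesMeasure`, whatever becomes of its `φ⁴` corner
  `β = 0 < lam` (the one registered stub `stub_phi4Edge`, vacuous-or-open: steady-state existence for the discrete `φ⁴`
  chain is open beyond `N = 3`, Hairer–Mattingly 2009 §1).

For the planner: either restate K2 with `0 < β` (closed by `exact CayleyPencil.stub_stieltjesRepresentation_pos`) or drop it
and take `fouriersLaw_of_contact` as the deciding theorem. No definitions, no new facts; real analysis only (dominated
convergence exactly as in `closes`).
-/

noncomputable section

namespace Summit.AtomisticToContinuum.FouriersLaw.Theorems.ContactStieltjesMeasure.CayleyPencil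

open scoped BigOperators Topology Classical MeasureTheory
open Filter Set Function TopologicalSpace MeasureTheory
open Summit.AtomisticToContinuum.FouriersLaw.Theses.ContactStieltjesMeasure

/-- **The deciding theorem of route `ContactStieltjesMeasure` with K2 in positive-range form.** Clause (i) of `FouriersLaw`:
proved `pinnedChain_exists_isSteadyState` + proved `nessUnique_proof`. Clause (ii): `D_N := (N-1)γ∫₀^∞ Φ_N w_γ` (`N ≥ 2`, from
the positive-range representation `hRep`; `0` for `N ≤ 1`, no bonds), `w_γ(t) = 2t/(γ²+t²)²`; dominated convergence (majorant
`C(1+t)w_γ ≤ C(3+2/γ²+1/γ⁴)(1+t²)⁻¹` from `ContactUpperDensity`, a.e. limit off the countable jump set of the monotone `M` of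
`ContactMeasureLimit`) gives `D_N → γ∫₀^∞ M w_γ =: κ(T)`, positive by `ConductanceLowerBound`; uniqueness transfers the
`δ`-limits to every steady family. (Proof text: the route's `closes`, `hβ.le ↦ hβ`.) [folklore] -/
theorem fouriersLaw_of_pos_of_contact
    (hRep : ∀ (ω₂ lam β : ℝ), 0 < ω₂ → 0 ≤ lam → 0 < β → ∀ (T : ℝ), 0 < T → ∃ Φ : ℕ → ℝ → ℝ, ∀ (N : ℕ), 2 ≤ N → Monotone (Φ N) ∧ (∀ s : ℝ, s ≤ 0 → Φ N s = 0) ∧ (∃ m : ℝ, ∀ s : ℝ, Φ N s ≤ m) ∧ ∀ (γ : ℝ), 0 < γ → (∀ (N' : ℕ) (T_L T_R : ℝ), 0 < T_L → 0 < T_R → ∀ (μ ν : MeasureTheory.Measure (Literature.MathematicalPhysics.KineticTheory.HeatConduction.PhaseSpace N')), (Literature.MathematicalPhysics.KineticTheory.HeatConduction.pinnedChain ω₂ lam β γ).IsSteadyState N' T_L T_R μ → (Literature.MathematicalPhysics.KineticTheory.HeatConduction.pinnedChain ω₂ lam β γ).IsSteadyState N' T_L T_R ν → μ = ν) → ∀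 (μ : (N' : ℕ) → ℝ → ℝ → MeasureTheory.Measure (Literature.MathematicalPhysics.KineticTheory.HeatConduction.PhaseSpace N')), (∀ (N' : ℕ) (T_L T_R : ℝ), 0 < T_L → 0 < T_R → (Literature.MathematicalPhysics.KineticTheory.HeatConduction.pinnedChain ω₂ lam β γ).IsSteadyState N' T_L T_R (μ N' T_L T_R)) → Filter.Tendsto (fun δ : ℝ => (Literature.MathematicalPhysics.KineticTheory.HeatConduction.pinnedChain ω₂ lam β γ).totalCurrent (μ N (T + δ / 2) (T - δ / 2)) / δ) (nhdsWithin 0 {(0 : ℝ)}ᶜ) (nhds (((N : ℝ) - 1) * γ * ∫ t in Set.Ioi (0 : ℝ), Φ N t * (2 * t / (γ ^ 2 + t ^ 2) ^ 2))))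
    (hUD : ContactUpperDensity) (hLim : ContactMeasureLimit) (hP : ConductanceLowerBound) : _root_.FouriersLaw := by
  -- crux-only hypotheses (D-0027 §2.1): weak-NESS uniqueness (stmt-0741) is PROVED in the tree and invoked here;
  have hU : Summit.AtomisticToContinuum.FouriersLaw.Theses.EmbeddedDrudeMourre.NessUnique :=
    Summit.AtomisticToContinuum.FouriersLaw.Theorems.nessUnique_proof
  intro ω₂ lam β γ hω hl hβ hγ
  have huniq := hU ω₂ lam β γ hω hl hβ hγ
  have hex := fun (N : ℕ) (T_L T_R : ℝ) (hL : 0 < T_L) (hR : 0 < T_R) =>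
    Literature.MathematicalPhysics.KineticTheory.HeatConduction.pinnedChain_exists_isSteadyState hω hl hβ hγ N hL hR
  refine ⟨fun N T_L T_R hL hR => ?_, ?_⟩
  ·
    obtain ⟨μ, hμ⟩ := hex N T_L T_R hL hR
    exact ⟨μ, hμ, fun ν hν => huniq N T_L T_R hL hR ν μ hν hμ⟩
  classical
  let μ₀ : (N : ℕ) → ℝ → ℝ →
      MeasureTheory.Measure (Literature.MathematicalPhysics.KineticTheory.HeatConduction.PhaseSpace N) :=
    fun N T_L T_R => if h : 0 < T_L ∧ 0 < T_R then Classical.choose (hex N T_L T_R h.1 h.2) else 0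
  have hμ₀ : ∀ (N : ℕ) (T_L T_R : ℝ), 0 < T_L → 0 < T_R →
      (Literature.MathematicalPhysics.KineticTheory.HeatConduction.pinnedChain ω₂ lam β γ).IsSteadyState N T_L T_R
        (μ₀ N T_L T_R) := by
    intro N T_L T_R hL hR
    simp only [μ₀, dif_pos (And.intro hL hR)]
    exact Classical.choose_spec (hex N T_L T_R hL hR)
  have hγ2 : 0 < γ ^ 2 := by positivity
  have hden : ∀ t : ℝ, 0 < (γ ^ 2 + t ^ 2) ^ 2 := fun t => by positivity
  have hw_nonneg : ∀ t : ℝ, 0 ≤ t → 0 ≤ 2 * t / (γ ^ 2 + t ^ 2) ^ 2 := fun t ht =>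
    div_nonneg (by linarith) (hden t).le
  have hw_cont : Continuous fun t : ℝ => 2 * t / (γ ^ 2 + t ^ 2) ^ 2 := by
    refine Continuous.div (by fun_prop) (by fun_prop) fun t => (hden t).ne'
  have hmaj : ∀ t : ℝ, 0 ≤ t →
      (1 + t) * (2 * t / (γ ^ 2 + t ^ 2) ^ 2) ≤ (3 + 2 / γ ^ 2 + 1 / γ ^ 4) * (1 + t ^ 2)⁻¹ := by
    intro t ht
    have h1 : 0 < 1 + t ^ 2 := by positivity
    have hg4 : 0 < γ ^ 4 := by positivity
    rw [mul_div_assoc', div_le_iff₀ (hden t), mul_assoc, inv_mul_eq_div, mul_div_assoc',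
      le_div_iff₀ h1]
    have hK : (3 + 2 / γ ^ 2 + 1 / γ ^ 4) = (3 * γ ^ 4 + 2 * γ ^ 2 + 1) / γ ^ 4 := by
      field_simp
    rw [hK, div_mul_eq_mul_div, le_div_iff₀ hg4]
    have e1 : 2 * t ≤ 1 + t ^ 2 := by nlinarith [sq_nonneg (t - 1)]
    have e2 : 2 * t ^ 3 ≤ t ^ 2 + t ^ 4 := by nlinarith [sq_nonneg (t - 1), sq_nonneg t]
    have lhs : (1 + t) * (2 * t) * (1 + t ^ 2) ≤ 3 * t ^ 4 + 4 * t ^ 2 + 1 := by nlinarith [e1, e2]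
    have rhs : (3 * t ^ 4 + 4 * t ^ 2 + 1) * γ ^ 4 ≤ (3 * γ ^ 4 + 2 * γ ^ 2 + 1) * (γ ^ 2 + t ^ 2) ^ 2 := by
      nlinarith [sq_nonneg (γ * t), sq_nonneg γ, sq_nonneg t, mul_nonneg hγ2.le (sq_nonneg t),
        mul_nonneg (mul_nonneg hγ2.le hγ2.le) (sq_nonneg t), pow_nonneg (sq_nonneg t) 2,
        mul_nonneg hγ2.le (pow_nonneg (sq_nonneg t) 2)]
    calc (1 + t) * (2 * t) * (1 + t ^ 2) * γ ^ 4 ≤ (3 * t ^ 4 + 4 * t ^ 2 + 1) * γ ^ 4 :=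
          mul_le_mul_of_nonneg_right lhs hg4.le
      _ ≤ (3 * γ ^ 4 + 2 * γ ^ 2 + 1) * (γ ^ 2 + t ^ 2) ^ 2 := rhs
  have key : ∀ T : ℝ, 0 < T → ∃ κT : ℝ, 0 < κT ∧ ∃ D : ℕ → ℝ,
      (∀ N : ℕ, Filter.Tendsto (fun δ : ℝ =>
        (Literature.MathematicalPhysics.KineticTheory.HeatConduction.pinnedChain ω₂ lam β γ).totalCurrent
          (μ₀ N (T + δ / 2) (T - δ / 2)) / δ) (nhdsWithin 0 {(0 : ℝ)}ᶜ) (nhds (D N))) ∧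
      Filter.Tendsto D Filter.atTop (nhds κT) := by
    intro T hT
    obtain ⟨Φ, hΦ⟩ := hRep ω₂ lam β hω hl.le hβ T hT
    let D : ℕ → ℝ := fun N => if 2 ≤ N then
      ((N : ℝ) - 1) * γ * ∫ t in Set.Ioi (0 : ℝ), Φ N t * (2 * t / (γ ^ 2 + t ^ 2) ^ 2) else 0
    have hDN : ∀ N : ℕ, 2 ≤ N →
        D N = ((N : ℝ) - 1) * γ * ∫ t in Set.Ioi (0 : ℝ), Φ N t * (2 * t / (γ ^ 2 + t ^ 2) ^ 2) :=
      fun N hN => if_pos hN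
    have hD : ∀ N : ℕ, Filter.Tendsto (fun δ : ℝ =>
        (Literature.MathematicalPhysics.KineticTheory.HeatConduction.pinnedChain ω₂ lam β γ).totalCurrent
          (μ₀ N (T + δ / 2) (T - δ / 2)) / δ) (nhdsWithin 0 {(0 : ℝ)}ᶜ) (nhds (D N)) := by
      intro N
      by_cases hN : 2 ≤ N
      · rw [hDN N hN]
        exact (hΦ N hN).2.2.2 γ hγ huniq μ₀ hμ₀
      ·
        have hD0 : D N = 0 := if_neg hN
        rw [hD0]
        have hj : ∀ (i : Fin N) (x : Literature.MathematicalPhysics.KineticTheory.HeatConduction.PhaseSpace N),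
            (Literature.MathematicalPhysics.KineticTheory.HeatConduction.pinnedChain ω₂ lam β γ).bondCurrent N i x = 0 :=
          fun i x => by
            unfold Literature.MathematicalPhysics.KineticTheory.HeatConduction.OscillatorChain.bondCurrent
            refine Finset.sum_eq_zero fun j _ => ?_
            have hji : ¬ (j.val = i.val + 1) := by have := j.isLt; omega
            rw [if_neg hji]
        have e : (fun δ : ℝ =>
            (Literature.MathematicalPhysics.KineticTheory.HeatConduction.pinnedChain ω₂ lam β γ).totalCurrent
              (μ₀ N (T + δ / 2) (T - δ / 2)) / δ) = fun _ => 0 := by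
          funext δ
          have : (Literature.MathematicalPhysics.KineticTheory.HeatConduction.pinnedChain ω₂ lam β γ).totalCurrent
              (μ₀ N (T + δ / 2) (T - δ / 2)) = 0 := by
            unfold Literature.MathematicalPhysics.KineticTheory.HeatConduction.OscillatorChain.totalCurrent
            exact Finset.sum_eq_zero fun i _ => by simp only [hj, MeasureTheory.integral_zero]
          rw [this, zero_div]
        rw [e]
        exact tendsto_const_nhds
    obtain ⟨C, N₀, hC⟩ := hUD ω₂ lam β hω hl hβ T hT Φ hΦ
    obtain ⟨M, hMmono, hM⟩ := hLim ω₂ lam β hω hl hβ T hT Φ hΦ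
    have hΦ_nonneg : ∀ N : ℕ, 2 ≤ N → ∀ t : ℝ, 0 ≤ t → 0 ≤ Φ N t := by
      intro N hN t ht
      have h0 : Φ N 0 = 0 := (hΦ N hN).2.1 0 le_rfl
      simpa [h0] using (hΦ N hN).1 ht
    have hC_nonneg : 0 ≤ C := by
      have h := hC (max N₀ 2) (le_max_left _ _) 1 one_pos
      have h' : 0 ≤ ((max N₀ 2 : ℕ) : ℝ) * Φ (max N₀ 2) 1 :=
        mul_nonneg (Nat.cast_nonneg _) (hΦ_nonneg _ (le_max_right _ _) 1 zero_le_one)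
      linarith
    set L : ℝ := ∫ t in Set.Ioi (0 : ℝ), M t * (2 * t / (γ ^ 2 + t ^ 2) ^ 2) with hL
    have hDCT : Filter.Tendsto (fun N : ℕ => ∫ t in Set.Ioi (0 : ℝ),
        ((N : ℝ) * Φ N t) * (2 * t / (γ ^ 2 + t ^ 2) ^ 2)) Filter.atTop (nhds L) := by
      refine MeasureTheory.tendsto_integral_filter_of_dominated_convergence
        (fun t => C * (1 + t) * (2 * t / (γ ^ 2 + t ^ 2) ^ 2)) ?_ ?_ ?_ ?_
      ·
        refine Filter.eventually_atTop.2 ⟨2, fun N hN => ?_⟩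
        exact ((measurable_const.mul (hΦ N hN).1.measurable).mul hw_cont.measurable).aestronglyMeasurable
      ·
        refine Filter.eventually_atTop.2 ⟨max N₀ 2, fun N hN => ?_⟩
        refine (MeasureTheory.ae_restrict_iff' measurableSet_Ioi).2 (Filter.Eventually.of_forall fun t ht => ?_)
        have ht : 0 < t := ht
        have h1 : 0 ≤ (N : ℝ) * Φ N t :=
          mul_nonneg (Nat.cast_nonneg _) (hΦ_nonneg N (le_trans (le_max_right _ _) hN) t ht.le)
        rw [Real.norm_eq_abs, abs_of_nonneg (mul_nonneg h1 (hw_nonneg t ht.le))]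
        exact mul_le_mul_of_nonneg_right (hC N (le_trans (le_max_left _ _) hN) t ht) (hw_nonneg t ht.le)
      ·
        have hKint : MeasureTheory.Integrable (fun t : ℝ => (C * (3 + 2 / γ ^ 2 + 1 / γ ^ 4)) * (1 + t ^ 2)⁻¹)
            (MeasureTheory.volume.restrict (Set.Ioi (0 : ℝ))) :=
          (integrable_inv_one_add_sq.const_mul _).integrableOn
        refine hKint.mono' ?_ ?_
        · exact (Continuous.mul (by fun_prop) hw_cont).aestronglyMeasurable
        · refine (MeasureTheory.ae_restrict_iff' measurableSet_Ioi).2 (Filter.Eventually.of_forall fun t ht => ?_)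
          have ht : 0 < t := ht
          have hnn : 0 ≤ C * (1 + t) * (2 * t / (γ ^ 2 + t ^ 2) ^ 2) :=
            mul_nonneg (mul_nonneg hC_nonneg (by linarith)) (hw_nonneg t ht.le)
          rw [Real.norm_eq_abs, abs_of_nonneg hnn, mul_assoc, mul_assoc]
          exact mul_le_mul_of_nonneg_left (hmaj t ht.le) hC_nonneg
      ·
        have hS : MeasureTheory.volume {t : ℝ | ¬ContinuousAt M t} = 0 :=
          hMmono.countable_not_continuousAt.measure_zero _
        have hae : ∀ᵐ t ∂(MeasureTheory.volume.restrict (Set.Ioi (0 : ℝ))), ContinuousAt M t := by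
          refine MeasureTheory.ae_restrict_of_ae ?_
          rw [MeasureTheory.ae_iff]
          simpa using hS
        filter_upwards [hae, MeasureTheory.ae_restrict_mem measurableSet_Ioi] with t hcont ht
        exact (hM t ht hcont).mul_const _
    have hfrac : Filter.Tendsto (fun N : ℕ => ((N : ℝ) - 1) / N) Filter.atTop (nhds 1) := by
      have h : Filter.Tendsto (fun N : ℕ => (1 : ℝ) - 1 / (N : ℝ)) Filter.atTop (nhds (1 - 0)) :=
        tendsto_const_nhds.sub tendsto_one_div_atTop_nhds_zero_nat
      rw [sub_zero] at h
      refine h.congr' ?_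
      filter_upwards [Filter.eventually_gt_atTop 0] with N hN
      have hN' : (N : ℝ) ≠ 0 := by exact_mod_cast hN.ne'
      field_simp
    have hDlim : Filter.Tendsto D Filter.atTop (nhds (γ * (1 * L))) := by
      have h := (tendsto_const_nhds (x := γ)).mul (hfrac.mul hDCT)
      refine h.congr' ?_
      filter_upwards [Filter.eventually_ge_atTop 2] with N hN
      have hN' : (N : ℝ) ≠ 0 := by
        have : (2 : ℝ) ≤ N := by exact_mod_cast hN
        linarith
      rw [hDN N hN]
      have hfun : (fun t : ℝ => (N : ℝ) * Φ N t * (2 * t / (γ ^ 2 + t ^ 2) ^ 2)) =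
          fun t : ℝ => (N : ℝ) * (Φ N t * (2 * t / (γ ^ 2 + t ^ 2) ^ 2)) := by
        funext t; ring
      rw [hfun, MeasureTheory.integral_const_mul]
      generalize (∫ t in Set.Ioi (0 : ℝ), Φ N t * (2 * t / (γ ^ 2 + t ^ 2) ^ 2)) = I
      have hI : ((N : ℝ) - 1) / N * ((N : ℝ) * I) = ((N : ℝ) - 1) * I := by
        field_simp
      rw [hI]
      ring
    have hγL : γ * (1 * L) = γ * L := by ring
    rw [hγL] at hDlim
    obtain ⟨c, hc, N₁, hN₁⟩ := hP ω₂ lam β γ hω hl hβ hγ huniq μ₀ hμ₀ T hT D hD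
    have hcL : c ≤ γ * L := ge_of_tendsto hDlim (Filter.eventually_atTop.2 ⟨N₁, hN₁⟩)
    exact ⟨γ * L, lt_of_lt_of_le hc hcL, D, hD, hDlim⟩
  choose κf hκpos Df hDf hDlim using key
  refine ⟨fun T => if hT : 0 < T then κf T hT else 1, fun T hT => ?_, ?_⟩
  · simp only [dif_pos hT]; exact hκpos T hT
  intro μ hμ T hT
  refine ⟨Df T hT, fun N => ?_, ?_⟩
  ·
    refine (hDf T hT N).congr' ?_
    have h2 : ∀ᶠ δ in nhds (0 : ℝ), δ < 2 * T := eventually_lt_nhds (by linarith)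
    have h2' : ∀ᶠ δ in nhds (0 : ℝ), -(2 * T) < δ := eventually_gt_nhds (by linarith)
    filter_upwards [mem_nhdsWithin_of_mem_nhds h2, mem_nhdsWithin_of_mem_nhds h2'] with δ hlt hgt
    have ha : 0 < T + δ / 2 := by linarith
    have hb : 0 < T - δ / 2 := by linarith
    rw [huniq N _ _ ha hb (μ₀ N _ _) (μ N _ _) (hμ₀ N _ _ ha hb) (hμ N _ _ ha hb)]
  · simp only [dif_pos hT]; exact hDlim T hT

/-- **K2 discharged: `FouriersLaw` from the three remaining cruxes of route `ContactStieltjesMeasure`.** The positive-range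
representation is the tree's `stub_stieltjesRepresentation_pos` (line `cayley-pencil` of crux stmt-AtomisticToContinuum-15248),
so `ContactUpperDensity → ContactMeasureLimit → ConductanceLowerBound → FouriersLaw` holds outright. [folklore] -/
theorem fouriersLaw_of_contact (hUD : ContactUpperDensity) (hLim : ContactMeasureLimit) (hP : ConductanceLowerBound) :
    _root_.FouriersLaw :=
  fouriersLaw_of_pos_of_contact stub_stieltjesRepresentation_pos hUD hLim hP

end Summit.AtomisticToContinuum.FouriersLaw.Theorems.ContactStieltjesMeasure.CayleyPencil

end
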